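import Summits.NavierStokesRegularity.NavierStokesRegularity.Theorems.TautCompressionIntegrable.Negative.SwirlStrainCalibration
import Literature.Analysis.FluidPDE.LeraySelfSimilarCalculus
import Literature.Analysis.FluidPDE.NSLerayHopfSereginEnergyProofs

/-!
# `TautCompressionIntegrable` is false without the momentum equation, part 4/4
(the Navier–Stokes dynamics is load-bearing; smoothness + incompressibility + decay do not suffice)

Negative-side support for the crux `TautLoopKelvin.TautCompressionIntegrable`
(stmt-NavierStokesRegularity-15248, route `TautLoopKelvin`, rank 2), cdisprove seat, 2026-08-17.
The witness `u(t,x) = λ(t)V_δ(λ(t)x)`, `λ = (1 − t)^{-1/2}` (Leray's backward zoom of the profile of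
parts 2–3): jointly smooth on `[0,1) × ℝ³`, divergence free and rapidly decaying at every time, with
near-taut compression `Λ_{2π}(u(s)) ≥ δ/(1 − s)` (`le_nearTautRate_uW`), hence no integrable majorant:
`tautCompressionIntegrable_false_without_momentum`. Theorems and the explicit witness only; nothing here
asserts a Theses statement.
-/

noncomputable section

namespace Summit.NavierStokesRegularity.NavierStokesRegularity.Theorems.TautCompressionIntegrable.Negative

open MeasureTheory Set Filter Metric Real intervalIntegral InnerProductSpace
open scoped ENNReal RealInnerProductSpace ContDiff Topology
open Literature.Analysis.FluidPDE

set_option linter.dupNamespace false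

local notation "ℝ³" => EuclideanSpace ℝ (Fin 3)

/-! ## The kinematic flow: Leray's self-similar zoom of the profile -/

/-- **The witness velocity** `u(t, x) = λ(t) V_δ(λ(t) x)`, `λ(t) = (1 − t)^{-1/2}`: Leray's backward
self-similar ansatz (`lerayBackward` with `a = 1/2`, `T = 1`) on the fixed profile `V_δ`. It is NOT a
Navier–Stokes solution (no compactly supported Leray profile exists, Nečas–Růžička–Šverák 1996); it is
smooth on `[0, 1) × ℝ³`, divergence free and compactly supported at every time. -/
def uW (δ : ℝ) : ℝ → ℝ³ → ℝ³ := lerayBackward (1 / 2) 1 (vW δ)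

/-- The Leray scale `λ(s) = (1 − s)^{-1/2}` is positive before the final time. -/
theorem scale_pos {s : ℝ} (hs : s < 1) : 0 < (Real.sqrt (2 * (1 / 2) * (1 - s)))⁻¹ :=
  lerayScale_pos one_half_pos hs

/-- `λ(s)² = (1 − s)⁻¹`. -/
theorem scale_sq {s : ℝ} (hs : s < 1) : ((Real.sqrt (2 * (1 / 2) * (1 - s)))⁻¹) ^ 2 = (1 - s)⁻¹ := by
  rw [lerayScale_sq one_half_pos hs]
  norm_num

/-- Joint smoothness on `[0, 1) × ℝ³`. -/
theorem isSmoothSpaceTimeOn_uW (δ : ℝ) : IsSmoothSpaceTimeOn (Set.Ico 0 1) (uW δ) :=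
  (contDiffOn_uncurry_lerayBackward one_half_pos (contDiff_vW δ) 1).mono
    (Set.prod_mono Set.Ico_subset_Iio_self subset_rfl)

/-- Every slice is divergence free. -/
theorem isDivFree_uW (δ t : ℝ) : VectorCalculus.IsDivFree (uW δ t) :=
  isDivFree_lerayBackward (isDivFree_vW δ) _ _ _

/-- Every slice is smooth. -/
theorem contDiff_uW (δ t : ℝ) : ContDiff ℝ ∞ (uW δ t) := by
  show ContDiff ℝ ∞ fun x => (Real.sqrt (2 * (1 / 2) * (1 - t)))⁻¹ •
    vW δ ((Real.sqrt (2 * (1 / 2) * (1 - t)))⁻¹ • x)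
  exact ((contDiff_vW δ).comp (contDiff_const_smul _)).const_smul _

/-- Every slice before the final time is compactly supported. -/
theorem hasCompactSupport_uW (δ : ℝ) {t : ℝ} (ht : t < 1) : HasCompactSupport (uW δ t) := by
  have hc : (Real.sqrt (2 * (1 / 2) * (1 - t)))⁻¹ ≠ 0 := (scale_pos ht).ne'
  show HasCompactSupport fun x => (Real.sqrt (2 * (1 / 2) * (1 - t)))⁻¹ •
    vW δ ((Real.sqrt (2 * (1 / 2) * (1 - t)))⁻¹ • x)
  exact ((hasCompactSupport_vW δ).comp_smul hc).mono fun x hx => by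
    rw [Function.mem_support] at hx ⊢
    intro h0
    exact hx (by rw [h0, smul_zero])

/-- Every slice before the final time is rapidly decaying (Fefferman's class). -/
theorem hasRapidSpatialDecay_uW (δ : ℝ) {t : ℝ} (ht : t < 1) : HasRapidSpatialDecay (uW δ t) :=
  HasRapidSpatialDecay.of_hasCompactSupport (contDiff_uW δ t) (hasCompactSupport_uW δ ht)

/-- **The near-taut compression of the zoomed profile is `≥ δ/(1 − s)`.** At time `s` the circle
`λ(s)⁻¹ γ₁` carries circulation `2π` (circulation is scale invariant), has the minimal admissible length
`2π/λ(s)` (calibration), and is compressed at rate `δ λ(s)²`. -/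
theorem le_nearTautRate_uW {δ C : ℝ} (hδ : 0 ≤ δ) (hC : ∀ x, ‖mRes x‖ ≤ C) (hδC : δ * C ≤ 1)
    {s : ℝ} (hs : s < 1) : δ * (1 - s)⁻¹ ≤ nearTautRate (uW δ s) (2 * π) := by
  set c : ℝ := (Real.sqrt (2 * (1 / 2) * (1 - s)))⁻¹ with hc_def
  have hc : 0 < c := scale_pos hs
  have hc2 : c ^ 2 = (1 - s)⁻¹ := scale_sq hs
  obtain ⟨L, hL0, hL⟩ := exists_bound_fderiv_vW δ
  have hu : uW δ s = nsRescaleData c (vW δ) := rfl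
  -- derivative bound on the slice
  have hDu : ∀ y, ‖fderiv ℝ (uW δ s) y‖ ≤ c ^ 2 * L := fun y => by
    rw [uW, fderiv_lerayBackward, ← hc_def, norm_smul, Real.norm_eq_abs, abs_of_nonneg (sq_nonneg _)]
    exact mul_le_mul_of_nonneg_left (hL _) (sq_nonneg _)
  -- the scaled circle
  set γc : ℝ → ℝ³ := fun σ => c⁻¹ • γ₁ σ with hγc
  have hγcC1 : IsC1Loop γc := isC1Loop_γ₁.const_smul c⁻¹
  have hpt : ∀ σ, c • γc σ = γ₁ σ := fun σ => by
    simp [hγc, smul_smul, mul_inv_cancel₀ hc.ne']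
  have hsmul : c • γc = γ₁ := funext hpt
  have hderivc : ∀ σ, deriv γc σ = c⁻¹ • deriv γ₁ σ := fun σ => by
    show deriv (c⁻¹ • γ₁) σ = _
    exact deriv_const_smul c⁻¹ (isC1Loop_γ₁.differentiable σ)
  have hlenc : len γc = c⁻¹ * (2 * π) := by
    rw [hγc, len_const_smul isC1Loop_γ₁ (inv_nonneg.2 hc.le), len_γ₁]
  -- circulation of the slice around the scaled circle
  have hcirc : circulation (uW δ s) γc = 2 * π := by
    rw [hu, circulation_nsRescaleData, hsmul, circulation_vW_γ₁]
  -- its compression rate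
  have hrate : rate (uW δ s) γc = δ * c ^ 2 := by
    unfold rate
    have hint : ∀ σ, -(⟪deriv γc σ, fderiv ℝ (uW δ s) (γc σ) (deriv γc σ)⟫) / ‖deriv γc σ‖ =
        δ * (2 * π) * c := by
      intro σ
      rw [hderivc, uW, fderiv_lerayBackward, ← hc_def, hpt]
      rw [smul_apply, map_smul, real_inner_smul_left, real_inner_smul_right,
        real_inner_smul_right, inner_fderiv_vW_γ₁, norm_smul, norm_inv, Real.norm_eq_abs,
        abs_of_pos hc, norm_deriv_γ₁]
      field_simp
    simp_rw [hint]
    rw [intervalIntegral.integral_const, show (∫ σ in (0:ℝ)..1, ‖deriv γc σ‖) = len γc from rfl,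
      hlenc, smul_eq_mul, sub_zero, one_mul]
    field_simp
  -- tautness: every admissible loop has length at least that of the scaled circle
  have htaut : ENNReal.ofReal (len γc) ≤ ell (uW δ s) (2 * π) := by
    rw [hlenc]
    refine ofReal_le_ell fun γ hγ hadm => ?_
    rw [hu, circulation_nsRescaleData] at hadm
    have hb := abs_circulation_vW_le hδ hC hδC (hγ.const_smul c)
    have hlen : len (c • γ) = c * len γ := len_const_smul hγ hc.le
    rw [hlen] at hb
    rw [inv_mul_le_iff₀ hc]
    exact hadm.trans hb
  have hadm : 2 * π ≤ |circulation (uW δ s) γc| := by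
    rw [hcirc, abs_of_pos two_pi_pos]
  have key := rate_le_nearTautRate (fun ε _ => bddAbove_tautSet (by positivity) hDu _ ε)
    hγcC1 hadm htaut
  rwa [hrate, hc2] at key

/-! ## The crux without the momentum equation is false -/

/-- **No integrable majorant along the witness**: at level `2π` the near-taut compression of the zoom
is `≥ δ/(1 − s)`, whose integral over `(0, 1)` diverges (`∫₀¹ ds/(1 − s) = ∞`, via
`intervalIntegrable_inv_iff`). -/
theorem uW_no_majorant {δ C : ℝ} (hδ : 0 < δ) (hC : ∀ x, ‖mRes x‖ ≤ C) (hδC : δ * C ≤ 1) :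
    ¬ ∃ (Φ : ℝ → ℝ) (M : ℝ), Measurable Φ ∧ 0 ≤ M ∧
      (∀ s ∈ Set.Ioo (0:ℝ) 1, nearTautRate (uW δ s) (2 * π) ≤ Φ s) ∧
      (∫⁻ s in Set.Ioo (0:ℝ) 1, ENNReal.ofReal (Φ s)) ≤ ENNReal.ofReal M := by
  rintro ⟨Φ, M, -, -, hmaj, hint⟩
  have hΦ : ∀ s ∈ Set.Ioo (0:ℝ) 1, δ * (1 - s)⁻¹ ≤ Φ s := fun s hs =>
    (le_nearTautRate_uW hδ.le hC hδC hs.2).trans (hmaj s hs)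
  have h1 : ∫⁻ s in Set.Ioo (0:ℝ) 1, ENNReal.ofReal (δ * (1 - s)⁻¹) ≤ ENNReal.ofReal M :=
    (setLIntegral_mono' measurableSet_Ioo fun s hs => ENNReal.ofReal_le_ofReal (hΦ s hs)).trans hint
  have h2 : IntegrableOn (fun s : ℝ => δ * (1 - s)⁻¹) (Set.Ioo 0 1) := by
    refine ⟨((measurable_const.sub measurable_id).inv.const_mul δ).aestronglyMeasurable, ?_⟩
    rw [hasFiniteIntegral_iff_ofReal (ae_restrict_of_forall_mem measurableSet_Ioo fun s hs => ?_)]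
    · exact h1.trans_lt ENNReal.ofReal_lt_top
    · exact mul_nonneg hδ.le (inv_nonneg.2 (by linarith [hs.2]))
  have h3 : IntervalIntegrable (fun s : ℝ => δ * (1 - s)⁻¹) volume 0 1 :=
    (intervalIntegrable_iff_integrableOn_Ioo_of_le zero_le_one).2 h2
  have h4 : IntervalIntegrable (fun s : ℝ => (1 - s)⁻¹) volume 0 1 := by
    have heq : (fun s : ℝ => (1 - s)⁻¹) = fun s => δ⁻¹ * (δ * (1 - s)⁻¹) := by
      funext s
      rw [← mul_assoc, inv_mul_cancel₀ hδ.ne', one_mul]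
    rw [heq]
    exact h3.const_mul δ⁻¹
  have h5 : IntervalIntegrable (fun s : ℝ => s⁻¹) volume 1 0 := by
    simpa using h4.comp_sub_left 1
  rcases intervalIntegrable_inv_iff.1 h5 with h6 | h6
  · exact one_ne_zero h6
  · exact h6 Set.right_mem_uIcc

/-- The amplitude `δ = 1/(sup|m| + 1)` of the strain used by the witness. -/
theorem exists_delta : ∃ δ C : ℝ, 0 < δ ∧ (∀ x, ‖mRes x‖ ≤ C) ∧ δ * C ≤ 1 := by
  obtain ⟨C, hC0, hC⟩ := exists_bound_mRes
  have hC1 : 0 < C + 1 := by linarith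
  refine ⟨(C + 1)⁻¹, C, inv_pos.2 hC1, hC, ?_⟩
  rw [inv_mul_le_iff₀ hC1]
  linarith

/-- **The Navier–Stokes dynamics is load-bearing for `TautCompressionIntegrable`.** The crux
`TautLoopKelvin.TautCompressionIntegrable` with the two Navier–Stokes hypotheses
`IsClassicalNSSolutionOn (Ico 0 T) ν 0 u p` and `IsLerayHopfOn T ν 0 (u 0) u` replaced by what they
provide KINEMATICALLY — joint smoothness of `u` on `[0,T) × ℝ³`, `div u(t) = 0`, and (more than the
crux asks) rapid decay of EVERY slice `u(t)`, `t < T` — is FALSE. Witness (`T = 1`, any `ν`): Leray's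
self-similar zoom `u(t, x) = λ(t) V_δ(λ(t) x)`, `λ = (1 − t)^{-1/2}`, of the smooth compactly supported
divergence-free profile `V_δ = v_sw + δ · curl(χ_b Ψ₀)` (a swirl concentrated on the unit circle plus a
localised Burgers strain, `δ = 1/(sup|m| + 1)`). At level `g = 2π` and every time `s < 1` the circle
`λ⁻¹γ₁` is an admissible loop of MINIMAL length (calibration: `∮_γ V_δ = ∮_γ (v_sw + δ m)` with
`|v_sw + δ m| ≤ 1`, so every admissible loop has length `≥ 2π/λ`), compressed at rate `δλ² = δ/(1 − s)`;
hence `Λ_{2π}(u(s)) ≥ δ/(1 − s)`, whose integral over `(0, 1)` diverges, and no integrable majorant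
exists. No blow-up of `‖u‖_{L²}` or of `∫‖∇u‖²_{L²} dt` is involved (the zoom is `L²`-subcritical):
the missing ingredient is the momentum equation, which forbids this Leray-type collapse of a compactly
supported profile (Nečas–Růžička–Šverák 1996, Tsai 1998). Information for provers: any proof of the crux
must use the equation beyond incompressibility, smoothness and decay — e.g. through the energy-class
a-priori control of `λ(t)` or a Liouville/rigidity input — exactly as the route's Type-I endgame says.
[cite: NecasRuzickaSverak1996, Thm. 1] [cite: Tsai1998, Thm. 1] -/
theorem tautCompressionIntegrable_false_without_momentum :
    ¬ (∀ (ν T : ℝ), 0 < ν → 0 < T → ∀ (u : ℝ → ℝ³ → ℝ³),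
        IsSmoothSpaceTimeOn (Set.Ico 0 T) u →
        (∀ t ∈ Set.Ico 0 T, VectorCalculus.IsDivFree (u t)) →
        (∀ t ∈ Set.Ico 0 T, HasRapidSpatialDecay (u t)) →
        ∀ g : ℝ, 0 < g → ∃ (Φ : ℝ → ℝ) (M : ℝ), Measurable Φ ∧ 0 ≤ M ∧
          (∀ s ∈ Set.Ioo 0 T, (⨅ ε : {ε : ℝ // 0 < ε}, sSup {k : ℝ | ∃ γ : ℝ → ℝ³,
            IsC1Loop γ ∧ g ≤ |circulation (u s) γ| ∧
            ENNReal.ofReal (∫ σ in (0:ℝ)..1, ‖deriv γ σ‖) ≤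
              (⨅ (γ' : ℝ → ℝ³) (_ : IsC1Loop γ' ∧ g ≤ |circulation (u s) γ'|),
                ENNReal.ofReal (∫ σ in (0:ℝ)..1, ‖deriv γ' σ‖)) + ENNReal.ofReal (ε : ℝ) ∧
            k = ((∫ σ in (0:ℝ)..1, -(inner ℝ (deriv γ σ) (fderiv ℝ (u s) (γ σ) (deriv γ σ))) /
              ‖deriv γ σ‖) / (∫ σ in (0:ℝ)..1, ‖deriv γ σ‖))}) ≤ Φ s) ∧
          (∫⁻ s in Set.Ioo 0 T, ENNReal.ofReal (Φ s)) ≤ ENNReal.ofReal M) := by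
  intro h
  obtain ⟨δ, C, hδ, hC, hδC⟩ := exists_delta
  exact uW_no_majorant hδ hC hδC (h 1 1 one_pos one_pos (uW δ) (isSmoothSpaceTimeOn_uW δ)
    (fun t _ => isDivFree_uW δ t) (fun t ht => hasRapidSpatialDecay_uW δ ht.2) (2 * π) two_pi_pos)

end Summit.NavierStokesRegularity.NavierStokesRegularity.Theorems.TautCompressionIntegrable.Negative

end
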